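import Literature.Computability.AlgebraicComplexity.PerDetExactMultiplicities
import Literature.Computability.AlgebraicComplexity.CoordRepRational
import Literature.Computability.AlgebraicComplexity.GCTObstructions
import Literature.Computability.AlgebraicComplexity.OrbitClosureWeights
import Literature.Computability.AlgebraicComplexity.PlethysmLifting
import Literature.NumberTheory.DiophantineGeometry.GLHighestWeightExistsUniqueProofs
import Literature.NumberTheory.DiophantineGeometry.GLHighestWeightMultiplicityProofs
import Literature.NumberTheory.DiophantineGeometry.SchurWeylPlethysmCoordRepWeightsProofs
import HarnessLib

/-!
# The degree-`d` piece of the ideal of an orbit closure vanishes iff no type of degree `d` drops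

Topic `Literature/Computability/AlgebraicComplexity`; companion of `PerDetExactMultiplicities.lean`
(per-type shapes "`a_χ ≤ mult_χ ⇒ no equation of type χ`") and `HwvIdealRankBound.lean`
(rank–nullity `mult_χ k[Δ_m[f]] + dim (HWV_χ ∩ I(GL·f)) = a_χ`).  Honest framing of the cell served
(`pub-gct`, papers/PneNP/gct-obstructions, Tranche 1c "low-degree ideal census of `Δ(det_3)` and
`Δ(per_3)`"): rung-1 multiplicity-obstruction search for permanent versus determinant at small
`(n, m)`; no claim about VP ≠ VNP or P ≠ NP.

**The printed principle.** Bürgisser–Ikenmeyer (STOC 2013, Prop. 3.3 and its proof): the vanishing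
ideal `I(\overline{G c})` "is a graded `G`-representation", every element decomposes into isotypic
pieces of the homogeneous parts `I(\overline{Gc})_d`, and each piece is generated by highest-weight
vectors (their Lemma 3.2), "when searching for polynomial obstructions, we can restrict ourselves
to HWVs".  In multiplicity language (BLMW 2011 §4.4; DIP20 (2.2); Bläser–Ikenmeyer 2025 Prop. 12.7):
`I(Δ_m[f])_d = 0` if and only if `mult_χ k[Δ_m[f]] = a_χ` for every highest weight `χ` of
`k[Sym^m (k^σ)]_d`.

This file proves exactly that, for an arbitrary homogeneous form `f` of degree `m ≠ 0` over a field
of characteristic zero, so that a TABLE of per-type certificates (`a ≤ r ≤ mult`, one rank cell per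
dominant type of degree `d`) becomes ONE statement about the ideal:

* `exists_hwv_of_mem_orbitVanishingIdeal` — a nonzero homogeneous element of degree `d` of
  `I(GL · f)` yields a nonzero HIGHEST-WEIGHT vector of `k[Sym^m]`, homogeneous of degree `d`, in
  `I(GL · f)` (Lie–Kolchin / `exists_hasHighestWeight_of_isRationalRep` on the finite-dimensional
  stable subspace `k[Sym^m]_d ∩ I(GL · f)`, rational by `isRationalRep_coordRep`);
* `size_eq_of_mem_weightSpace_of_isHomogeneous` — a nonzero weight vector of weight `χ`, homogeneous
  of degree `d`, has `|χ| = -m d` (a weight pins the degree, BLMW §4.4);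
* `orbitVanishingIdeal_degree_eq_zero_of_forall_weight` — if `a_χ ≤ mult_χ k[Δ_m[f]]` for every
  weight `χ` with `|χ| = -m d`, then every homogeneous `Ψ ∈ I(GL · f)` of degree `d` is zero;
  `orbitMultiplicity_eq_plethysmCoeff_of_degree_eq_zero` — the converse; hence the `iff`
  `orbitVanishingIdeal_degree_eq_zero_iff`;
* `orbitVanishingIdeal_degree_eq_zero_of_forall_partition` — the cell's indexation on matrix
  variables `MatIdx m`: it suffices to check the weights `λ*` (`(Weight.dualOfPartition (m·m) λ).toMatIdx`)
  of the partitions `λ ⊢ m d` with at most `m²` parts (BLMW (5.2.2): these are all the highest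
  weights of degree `d`, `exists_eq_dualOfPartition_of_hasHighestWeight_orbitCoordRep_of_size_eq`);
  specialisations `…_det` / `…_paddedPer` name the two orbit closures of the cell.

No definitions, no named facts.  The structure of the first proof follows the tree's
`Summit.…ValuativeFlip.os_exists_hwv_sep` (cell ValuativeGCT), here in the Literature namespace
over a general field and with the degree kept.

## References

* P. Bürgisser, C. Ikenmeyer, *Explicit lower bounds via geometric complexity theory*, STOC 2013
  = arXiv:1210.8368, §3.3 Lemma 3.2, Prop. 3.3 ("HWV obstructions"). [BurgisserIkenmeyer2013]
* P. Bürgisser, J. M. Landsberg, L. Manivel, J. Weyman, *An overview of mathematical issues arising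
  in the geometric complexity theory approach to VP ≠ VNP*, SIAM J. Comput. 40 (2011), §4.4,
  (5.2.2). [BLMW2011]
* J. Dörfler, C. Ikenmeyer, G. Panova, *On geometric complexity theory: Multiplicity obstructions
  are stronger than occurrence obstructions*, SIAM J. Appl. Algebra Geom. 4 (2020), §2 (2.2), §5.
  [DorflerIkenmeyerPanova2020]
* R. Goodman, N. Wallach, *Symmetry, Representations, and Invariants*, GTM 255, §3.2.1, Thm. 11.4.2.
  [GoodmanWallachGTM255]

## Mathlib and tree

Mathlib: `Subrepresentation`, `MvPolynomial.homogeneousSubmodule`, `MvPolynomial.IsHomogeneous`.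
Tree: `coordRep`, `orbitVanishingIdeal`, `orbitVanishingIdeal_le_comap_coordSubst`, `coordRep_apply`
(`OrbitCoordinateRing.lean`); `isHomogeneous_coordSubst` (`GCTObstructions.lean`);
`isRationalRep_coordRep` (`CoordRepRational.lean`); `exists_hasHighestWeight_of_isRationalRep`,
`IsRationalRep.toRepresentation`, `mem_highestWeightSpace_toRepresentation_iff`,
`hasHighestWeight_iff_exists`, `highestWeightSpace_le_weightSpace` (`GLHighestWeight*.lean`);
`monWeight_eq_of_mem_weightSpace` (`PlethysmLifting.lean`), `size_monWeight`,
`exists_eq_dualOfPartition_of_hasHighestWeight_orbitCoordRep_of_size_eq` (`OrbitClosureWeights.lean`);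
`exists_hasHighestWeight_orbitCoordRep_of_hasHighestWeight_coordRep`
(`SchurWeylPlethysmCoordRepWeightsProofs.lean`); `orbitMultiplicity_add_finrank_inf_eq_plethysmCoeff`
(`HwvIdealRankBound.lean`); `eq_zero_of_mem_hwv_of_mem_orbitVanishingIdeal_of_le`
(`PerDetExactMultiplicities.lean`); `finite_homogeneousSubmodule` (`MultiplicityObstructionsProofs.lean`).
-/

noncomputable section

open MvPolynomial

namespace Literature.Computability.AlgebraicComplexity

open _root_.Literature.NumberTheory.DiophantineGeometry

section General

variable {σ : Type} [Fintype σ] [LinearOrder σ] {k : Type} [Field k]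

/-! ### 1. A nonzero homogeneous equation yields a nonzero highest-weight equation of the same degree -/

/-- **Highest-weight equations suffice** (Bürgisser–Ikenmeyer 2013, proof of Prop. 3.3: the ideal
is a graded `G`-representation generated in each degree by highest-weight vectors). Over an
infinite field: if `Ψ ≠ 0` is homogeneous of degree `d` (in the coefficients of forms) and vanishes
on the orbit `GL · f`, then some nonzero HIGHEST-WEIGHT vector `F` of `k[Sym^m (k^σ)]`, homogeneous
of degree `d`, vanishes on `GL · f` as well.  Proof: `k[Sym^m]_d ∩ I(GL · f)` is a nonzero
finite-dimensional `GL`-stable subspace of the rational representation `k[Sym^m]`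
(`isHomogeneous_coordSubst`, `orbitVanishingIdeal_le_comap_coordSubst`, `isRationalRep_coordRep`),
hence has a highest-weight vector (`exists_hasHighestWeight_of_isRationalRep`, Lie–Kolchin).
[cite: BurgisserIkenmeyer2013, §3.3 Prop. 3.3] -/
theorem exists_hwv_of_mem_orbitVanishingIdeal [Infinite k] {f : MvPolynomial σ k} {m d : ℕ}
    {Ψ : MvPolynomial (DegIdx σ m) k} (hΨI : Ψ ∈ orbitVanishingIdeal f m) (hΨ0 : Ψ ≠ 0)
    (hΨd : Ψ.IsHomogeneous d) :
    ∃ (χ : Weight σ) (F : MvPolynomial (DegIdx σ m) k),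
      F ∈ highestWeightSpace (coordRep σ k m) χ ∧ F ∈ orbitVanishingIdeal f m ∧ F ≠ 0 ∧
        F.IsHomogeneous d := by
  classical
  -- the stable subspace `W = k[Sym^m]_d ∩ I(GL · f)`
  let W : Submodule k (MvPolynomial (DegIdx σ m) k) :=
    homogeneousSubmodule (DegIdx σ m) k d ⊓ (orbitVanishingIdeal f m).restrictScalars k
  have hWstab : ∀ (g : GL σ k) (v : MvPolynomial (DegIdx σ m) k), v ∈ W →
      coordRep σ k m g v ∈ W := by
    intro g v hv
    refine ⟨?_, ?_⟩
    · have h1 : v.IsHomogeneous d := (mem_homogeneousSubmodule d v).mp hv.1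
      change coordRep σ k m g v ∈ homogeneousSubmodule (DegIdx σ m) k d
      rw [mem_homogeneousSubmodule, coordRep_apply]
      exact isHomogeneous_coordSubst g h1
    · have h2 : v ∈ orbitVanishingIdeal f m := hv.2
      change coordRep σ k m g v ∈ orbitVanishingIdeal f m
      rw [coordRep_apply]
      exact orbitVanishingIdeal_le_comap_coordSubst f m g h2
  let V₁ : Subrepresentation (coordRep σ k m) := ⟨W, fun g _ hv => hWstab g _ hv⟩
  haveI : Module.Finite k ↥(homogeneousSubmodule (DegIdx σ m) k d) :=
    finite_homogeneousSubmodule _ _ _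
  haveI : Module.Finite k ↥V₁.toSubmodule :=
    Module.Finite.of_injective (Submodule.inclusion (inf_le_left : W ≤ _))
      (Submodule.inclusion_injective _)
  have hΨW : Ψ ∈ V₁.toSubmodule := ⟨(mem_homogeneousSubmodule d Ψ).mpr hΨd, hΨI⟩
  haveI : Nontrivial ↥V₁.toSubmodule :=
    ⟨⟨⟨Ψ, hΨW⟩, 0, fun h => hΨ0 (congrArg Subtype.val h)⟩⟩
  have hρ₁ : IsRationalRep V₁.toRepresentation := (isRationalRep_coordRep m).toRepresentation V₁
  obtain ⟨χ, hχ⟩ := exists_hasHighestWeight_of_isRationalRep V₁.toRepresentation hρ₁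
  obtain ⟨v, hv0, hv⟩ := (hasHighestWeight_iff_exists _ _).mp hχ
  refine ⟨χ, (v : MvPolynomial (DegIdx σ m) k),
    (mem_highestWeightSpace_toRepresentation_iff V₁ χ v).mp hv, v.2.2, ?_, ?_⟩
  · exact fun h => hv0 (Subtype.ext h)
  · exact (mem_homogeneousSubmodule d _).mp v.2.1

/-! ### 2. A weight pins the degree -/

/-- **A weight pins the degree** (BLMW 2011 §4.4): a nonzero torus weight vector of
`k[Sym^m (k^σ)]` of weight `χ` which is homogeneous of degree `d` has `|χ| = -m·d` (every monomial
in its support has weight `χ`, `monWeight_eq_of_mem_weightSpace`, and a monomial of degree `d` has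
weight of size `-m d`, `size_monWeight`). [cite: BLMW2011, §4.4] -/
theorem size_eq_of_mem_weightSpace_of_isHomogeneous [Infinite k] {m d : ℕ} {χ : Weight σ}
    {F : MvPolynomial (DegIdx σ m) k} (hF : F ∈ weightSpace (coordRep σ k m) χ) (hF0 : F ≠ 0)
    (hFd : F.IsHomogeneous d) : χ.size = -((m * d : ℕ) : ℤ) := by
  classical
  obtain ⟨s, hs⟩ : ∃ s, s ∈ F.support := by
    by_contra h
    push Not at h
    exact hF0 (MvPolynomial.ext _ _ fun s => by
      simpa [MvPolynomial.mem_support_iff] using h s)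
  have hw := monWeight_eq_of_mem_weightSpace hF hs
  have hsize := size_monWeight s
  rw [hw] at hsize
  have hdeg : s.degree = d := by
    have h := hFd (MvPolynomial.mem_support_iff.mp hs)
    rw [← h, Finsupp.degree_eq_weight_one]
    rfl
  rw [hsize, hdeg]

/-- Highest-weight vectors are weight vectors: the same degree statement for `HWV_χ`.
[cite: BLMW2011, §4.4] -/
theorem size_eq_of_mem_highestWeightSpace_of_isHomogeneous [Infinite k] {m d : ℕ} {χ : Weight σ}
    {F : MvPolynomial (DegIdx σ m) k} (hF : F ∈ highestWeightSpace (coordRep σ k m) χ)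
    (hF0 : F ≠ 0) (hFd : F.IsHomogeneous d) : χ.size = -((m * d : ℕ) : ℤ) :=
  size_eq_of_mem_weightSpace_of_isHomogeneous (highestWeightSpace_le_weightSpace _ _ hF) hF0 hFd

/-! ### 3. The criterion -/

/-- **No type of degree `d` drops ⇒ `I(Δ_m[f])_d = 0`.**  For a homogeneous form `f` of degree
`m ≠ 0` (characteristic zero): if `a_χ ≤ mult_χ k[Δ_m[f]]` for every weight `χ` with `|χ| = -m d`
(e.g. one rank certificate reaching the plethysm coefficient per dominant type of degree `d`; the
inequality is automatic when `a_χ = 0`), then every homogeneous polynomial of degree `d` in the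
coefficients of forms that vanishes on `GL · f` is zero.  Bürgisser–Ikenmeyer 2013 Prop. 3.3 with
the rank–nullity of DIP20 (2.2). [cite: BurgisserIkenmeyer2013, §3.3 Prop. 3.3] -/
theorem orbitVanishingIdeal_degree_eq_zero_of_forall_weight [CharZero k] {f : MvPolynomial σ k}
    {m : ℕ} (hm : m ≠ 0) (hf : f.IsHomogeneous m) {d : ℕ}
    (H : ∀ χ : Weight σ, χ.size = -((m * d : ℕ) : ℤ) →
      plethysmCoeff k σ m χ ≤ orbitMultiplicity k f m χ)
    {Ψ : MvPolynomial (DegIdx σ m) k} (hΨI : Ψ ∈ orbitVanishingIdeal f m)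
    (hΨd : Ψ.IsHomogeneous d) : Ψ = 0 := by
  haveI : Infinite k := CharZero.infinite k
  by_contra hΨ0
  obtain ⟨χ, F, hF, hFI, hF0, hFd⟩ := exists_hwv_of_mem_orbitVanishingIdeal hΨI hΨ0 hΨd
  have hsize := size_eq_of_mem_highestWeightSpace_of_isHomogeneous hF hF0 hFd
  exact hF0 (eq_zero_of_mem_hwv_of_mem_orbitVanishingIdeal_of_le (k := k) hm hf (H χ hsize) hF hFI)

/-- A highest-weight vector of `k[Sym^m]` of weight `χ` with `|χ| = -m d` is homogeneous of degree
`d` (all its monomials have weight `χ`, hence degree `d`). [cite: BLMW2011, §4.4] -/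
theorem isHomogeneous_of_mem_weightSpace_of_size_eq [Infinite k] {m d : ℕ} (hm : m ≠ 0)
    {χ : Weight σ} (hχ : χ.size = -((m * d : ℕ) : ℤ)) {F : MvPolynomial (DegIdx σ m) k}
    (hF : F ∈ weightSpace (coordRep σ k m) χ) : F.IsHomogeneous d := by
  classical
  intro s hs
  have hs' : s ∈ F.support := MvPolynomial.mem_support_iff.mpr hs
  have hw := monWeight_eq_of_mem_weightSpace hF hs'
  have hsize := size_monWeight s
  rw [hw, hχ] at hsize
  have hdeg : s.degree = d := by
    have h1 : ((m * d : ℕ) : ℤ) = ((m * s.degree : ℕ) : ℤ) := neg_injective hsize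
    have h2 : m * d = m * s.degree := by exact_mod_cast h1
    exact (Nat.eq_of_mul_eq_mul_left (Nat.pos_of_ne_zero hm) h2).symm
  rw [← hdeg, Finsupp.degree_eq_weight_one]
  rfl

/-- **Converse: `I(Δ_m[f])_d = 0 ⇒ no type of degree `d` drops.** If every homogeneous element of
degree `d` of `I(GL · f)` vanishes, then `mult_χ k[Δ_m[f]] = a_χ` for every weight `χ` with
`|χ| = -m d` (`m ≠ 0`, characteristic zero): the space `HWV_χ ∩ I(GL · f)` is zero because its
members are homogeneous of degree `d`, and rank–nullity (`orbitMultiplicity_add_finrank_inf_eq_plethysmCoeff`).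
[cite: DorflerIkenmeyerPanova2020, §5] -/
theorem orbitMultiplicity_eq_plethysmCoeff_of_degree_eq_zero [CharZero k] (f : MvPolynomial σ k)
    {m : ℕ} (hm : m ≠ 0) {d : ℕ}
    (H : ∀ Ψ : MvPolynomial (DegIdx σ m) k, Ψ ∈ orbitVanishingIdeal f m → Ψ.IsHomogeneous d → Ψ = 0)
    {χ : Weight σ} (hχ : χ.size = -((m * d : ℕ) : ℤ)) :
    orbitMultiplicity k f m χ = plethysmCoeff k σ m χ := by
  haveI : Infinite k := CharZero.infinite k
  have hrn := orbitMultiplicity_add_finrank_inf_eq_plethysmCoeff (k := k) f hm χ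
  have hbot : highestWeightSpace (coordRep σ k m) χ ⊓ (orbitVanishingIdeal f m).restrictScalars k
      = ⊥ := by
    rw [Submodule.eq_bot_iff]
    intro F hF
    exact H F hF.2 (isHomogeneous_of_mem_weightSpace_of_size_eq hm hχ
      (highestWeightSpace_le_weightSpace _ _ hF.1))
  rw [hbot, finrank_bot, add_zero] at hrn
  exact hrn

/-- **The criterion.** For a homogeneous form `f` of degree `m ≠ 0` in characteristic zero and a
degree `d`: `I(Δ_m[f])` has no nonzero homogeneous element of degree `d` if and only if
`mult_χ k[Δ_m[f]] = a_χ` for every weight `χ` of degree `d` (`|χ| = -m d`).  Bürgisser–Ikenmeyer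
2013 Prop. 3.3; BLMW 2011 §4.4; Bläser–Ikenmeyer 2025 Prop. 12.7. [cite: BurgisserIkenmeyer2013, §3.3 Prop. 3.3] -/
theorem orbitVanishingIdeal_degree_eq_zero_iff [CharZero k] {f : MvPolynomial σ k} {m : ℕ}
    (hm : m ≠ 0) (hf : f.IsHomogeneous m) (d : ℕ) :
    (∀ Ψ : MvPolynomial (DegIdx σ m) k, Ψ ∈ orbitVanishingIdeal f m → Ψ.IsHomogeneous d → Ψ = 0) ↔
      ∀ χ : Weight σ, χ.size = -((m * d : ℕ) : ℤ) →
        orbitMultiplicity k f m χ = plethysmCoeff k σ m χ :=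
  ⟨fun H _ hχ => orbitMultiplicity_eq_plethysmCoeff_of_degree_eq_zero f hm H hχ,
    fun H _ hΨI hΨd => orbitVanishingIdeal_degree_eq_zero_of_forall_weight hm hf
      (fun χ hχ => (H χ hχ).ge) hΨI hΨd⟩

end General

/-! ### 4. Matrix variables: indexation by partitions `λ ⊢ m·d` with at most `m²` parts -/

section MatIdx

variable {k : Type} [Field k]

/-- **Partition-indexed criterion on `MatIdx m`.** For a homogeneous form `f` of degree `m ≠ 0` on
the `m²` lexicographically ordered matrix variables (characteristic zero) and a degree `d`: if for
every partition `λ ⊢ m d` with at most `m²` parts a certificate gives `a_{λ*} ≤ mult_{λ*} k[Δ_m[f]]`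
(`λ* = (Weight.dualOfPartition (m·m) λ).toMatIdx`, the convention of `PerDetMultiplicityObstruction.lean`),
then `I(Δ_m[f])_d = 0`.  Reduction to §3: a highest weight `χ` of `k[Sym^m]` of degree `d` is such
a `λ*` (BLMW (5.2.2), `exists_eq_dualOfPartition_of_hasHighestWeight_orbitCoordRep_of_size_eq` via
`exists_hasHighestWeight_orbitCoordRep_of_hasHighestWeight_coordRep`). [cite: BLMW2011, (5.2.2)] -/
theorem orbitVanishingIdeal_degree_eq_zero_of_forall_partition [CharZero k] {m : ℕ} [NeZero m]
    {f : MvPolynomial (MatIdx m) k} (hf : f.IsHomogeneous m) {d : ℕ}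
    (H : ∀ lam : Nat.Partition (m * d), lam.parts.card ≤ m * m →
      plethysmCoeff k (MatIdx m) m (Weight.dualOfPartition (m * m) lam).toMatIdx ≤
        orbitMultiplicity k f m (Weight.dualOfPartition (m * m) lam).toMatIdx)
    {Ψ : MvPolynomial (DegIdx (MatIdx m) m) k} (hΨI : Ψ ∈ orbitVanishingIdeal f m)
    (hΨd : Ψ.IsHomogeneous d) : Ψ = 0 := by
  haveI : Infinite k := CharZero.infinite k
  by_contra hΨ0
  obtain ⟨χ, F, hF, hFI, hF0, hFd⟩ := exists_hwv_of_mem_orbitVanishingIdeal hΨI hΨ0 hΨd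
  have hsize := size_eq_of_mem_highestWeightSpace_of_isHomogeneous hF hF0 hFd
  -- `χ` is a highest weight of `k[Sym^m]`, hence of some `k[Δ_m[f']]`, hence a dual partition weight
  have hHW : HasHighestWeight (coordRep (MatIdx m) k m) χ :=
    (hasHighestWeight_iff_exists _ _).mpr ⟨F, hF0, hF⟩
  obtain ⟨f', -, hf'⟩ := exists_hasHighestWeight_orbitCoordRep_of_hasHighestWeight_coordRep hHW
  obtain ⟨lam', hlamN, hlam⟩ :=
    exists_eq_dualOfPartition_of_hasHighestWeight_orbitCoordRep_of_size_eq (matIdxEquiv m) f' hf'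
      hsize
  let lam : Nat.Partition (m * d) := ⟨lam'.parts, lam'.parts_pos, by rw [lam'.parts_sum, mul_comm]⟩
  have hχ : χ = (Weight.dualOfPartition (m * m) lam).toMatIdx := by rw [hlam]; rfl
  have hle := H lam hlamN
  rw [← hχ] at hle
  exact hF0 (eq_zero_of_mem_hwv_of_mem_orbitVanishingIdeal_of_le (k := k) (NeZero.ne m) hf hle hF hFI)

/-- **Tranche 1c-i shape: `I(Δ(det_m))_d = 0`** from one det-side certificate `a ≤ r_det ≤ mult`
per partition `λ ⊢ m d`, `ℓ(λ) ≤ m²`. [cite: BLMW2011, (5.2.2)] -/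
theorem orbitVanishingIdeal_det_degree_eq_zero_of_forall_partition [CharZero k] {m : ℕ} [NeZero m]
    {d : ℕ}
    (H : ∀ lam : Nat.Partition (m * d), lam.parts.card ≤ m * m →
      plethysmCoeff k (MatIdx m) m (Weight.dualOfPartition (m * m) lam).toMatIdx ≤
        orbitMultiplicity k (detFormLex k m) m (Weight.dualOfPartition (m * m) lam).toMatIdx)
    {Ψ : MvPolynomial (DegIdx (MatIdx m) m) k} (hΨI : Ψ ∈ orbitVanishingIdeal (detFormLex k m) m)
    (hΨd : Ψ.IsHomogeneous d) : Ψ = 0 :=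
  orbitVanishingIdeal_degree_eq_zero_of_forall_partition (detFormLex_isHomogeneous k m) H hΨI hΨd

/-- **Tranche 1c-ii shape: `I(Δ(X₀₀^{m-n} per_n))_d = 0`** (`n ≤ m`; at `n = m` this is the
orbit closure of `per_m` in the lexicographic matrix variables) from one permanent-side
certificate `a ≤ r ≤ mult` per partition `λ ⊢ m d`, `ℓ(λ) ≤ m²`. [cite: BLMW2011, (5.2.2)] -/
theorem orbitVanishingIdeal_paddedPer_degree_eq_zero_of_forall_partition [CharZero k] {n m : ℕ}
    [NeZero m] (hnm : n ≤ m) {d : ℕ}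
    (H : ∀ lam : Nat.Partition (m * d), lam.parts.card ≤ m * m →
      plethysmCoeff k (MatIdx m) m (Weight.dualOfPartition (m * m) lam).toMatIdx ≤
        orbitMultiplicity k (paddedPerFormLex k n m) m (Weight.dualOfPartition (m * m) lam).toMatIdx)
    {Ψ : MvPolynomial (DegIdx (MatIdx m) m) k}
    (hΨI : Ψ ∈ orbitVanishingIdeal (paddedPerFormLex k n m) m) (hΨd : Ψ.IsHomogeneous d) :
    Ψ = 0 :=
  orbitVanishingIdeal_degree_eq_zero_of_forall_partition (paddedPerFormLex_isHomogeneous (k := k) hnm)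
    H hΨI hΨd

end MatIdx

end Literature.Computability.AlgebraicComplexity
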